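import Mathlib.Analysis.Calculus.ContDiff.Basic
import Mathlib.Analysis.Calculus.FDeriv.Basic
import Literature.MathematicalPhysics.QuantumLattice.GrassmannIntegral
import HarnessLib
import Mathlib.Analysis.SpecialFunctions.ExpDeriv
import Mathlib.Analysis.SpecialFunctions.Trigonometric.Basic
import Mathlib.Algebra.Order.Round
import Literature.MathematicalPhysics.QuantumLattice.GrassmannIntegralProofs

/-!
# Barrier: the Vafa–Witten eigenvalue inequality — no gauge field gaps the massless Dirac
# operator (so massless multi-flavour QCD has no mass gap)

Barrier catalogue `Literature/Barriers/QuantumFields/` (D-0021), summit `QuantumFields`,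
sub-problem `ChiralRegime` (two- and three-flavour `SU(3)` QCD for all positive quark masses,
reaching the chiral regime; draft `docs/m5/drafts/QuantumFields.ChiralRegime.Statement.lean`;
conjunct vocabulary `Literature.MathematicalPhysics.QuantumFieldTheory.QCD`; Euclidean gamma
matrices `Literature.MathematicalPhysics.QuantumLattice.euclideanGamma`). Companion to the
catalogued anomaly-matching barrier `Literature.Barriers.QuantumFields.tHooftAnomalyMatching`
("That result also follows from triangle anomalies, so only our method is novel", abstract).

## The printed results (Vafa–Witten, Commun. Math. Phys. 95 (1984) 257–276)

*Abstract* (p. 257): "We show that QCD with a sufficient number of fermions of zero bare mass has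
physical massless particles. … Our method involves proving special cases of recently conjectured
paramagnetic inequalities for fermions. The proofs are simple applications of the
Atiyah–Patodi–Singer theorem on spectral flow."

*The eigenvalue theorems* (§III, p. 262): "Consider an arbitrary compact Riemannian manifold `M`
(without boundary) of dimension `d` … Let `A` be an arbitrary gauge field on this manifold (with
any compact gauge group `G`). Let `D̸_A` be the Dirac operator for fermions `ψ` in some
representation `T` of `G`, and let `λ_i` be the eigenvalues of `D̸_A`, in order of ascending
absolute value. We will prove `λ₁ ≤ C` (20) with a constant `C` that depends on `M` and on the
metric `g_ij` but not on the gauge field `A`. More generally, we will prove `λ_n ≤ C n^{1/d}` (21)."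
For manifolds of fixed shape and volume `V` this reads `λ₁ ≤ C V^{-1/d}`, `λ_n ≤ C (n/V)^{1/d}`
((9), (13), p. 260). Odd `d` (p. 264, after (27)): "`|λ_{a+1} - λ_a| ≤ C` … regardless of `A`,
there can be no large 'gaps' in the Dirac spectrum"; this stronger statement "is not true in
general for even dimensional manifolds. (For a constant magnetic field in two dimensions, the
spectrum has gaps of width `2|B|`, which can be arbitrarily big.)" (p. 265). *Sharp flat-torus
form* (pp. 267–269): on a torus with flat metric and fermions obeying periodic boundary
conditions, let `λ_M` be the maximum over constant `U(1)` fields of the lowest free eigenvalue —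
"if one takes the standard rectangular metric on the torus, `g_ij = δ_ij`, the maximum of `λ₁`
occurs for `a₁ = a₂ = … = a_d = 1/2` and is `λ_M = ½√d`" (angular coordinates of period `2π`);
"What we will prove is that for any gauge field with any group `G`, `λ₁` is at most equal to
`λ_M`" (p. 268), "so the magnitude of the lowest eigenvalue of `D̸_A` is at most `λ_M`, as we
wished to prove" (p. 269). For a flat `4`-torus of side `L` (coordinates rescaled by `L/2π`) this
is `|λ₁| ≤ (2π/L) · ½√4 = 2π/L`.

*The QCD consequence* (§§I–II): "if there are a sufficient number of quark flavors of zero bare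
mass (we need at least four flavors), then there is no mass gap in a channel with the quantum
numbers of `q̄q`" (p. 258). With `S(k)` the integrated flavour-chain correlator (2)–(3): "If the
theory has a mass gap, Green's functions show exponential clustering and the integral in (3)
converges. We will show that the theory with `n ≥ 4` has no mass gap by showing that this
integral diverges for `k ≥ 4`" (p. 259); in a background field `S_A(k) = V⁻¹ Σ_i λ_i^{-k}` (8),
and the eigenvalue bounds give `S(k) ≥ C_k S₀(k)` (5), (10), (15) after averaging with the
"ordinary, real, positive measure" `dμ = Z⁻¹ e^{-∫ F²/4g²} det(D̸ + M) Π dA` (1) — "Inequality (15)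
shows that there is no mass gap if there are four or more flavors of zero bare mass" (p. 261);
"Our results really imply the absence of mass gap for states in the adjoint representation of
the flavor group" (p. 261). Rigor caveat printed on p. 259: "For rigor, we should also introduce a
suitable cutoff in the gauge field integration, such as the gauge invariant Pauli–Villars
procedure that has been rigorously formulated by Asorey and Mitter." On chiral symmetry breaking
(p. 261, with the Banks–Casher formula (19) `lim_{m→0}⟨ψ̄ψ⟩ = πρ(0)`): "To establish chiral
symmetry breaking one must show an accumulation of eigenvalues at `λ = 0` … Although we cannot
prove this, we can show that the opposite does not occur; there is no depletion of Dirac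
eigenvalues near `λ = 0` … Up to an overall constant, the spectral density near `0` for the Dirac
operator with any gauge field is at least as big as the free one."

## What is vendored

`VafaWittenEigenvalueBound` is the sharp flat-torus theorem in `d = 4` for the trivial bundle:
for every `N ≥ 1`, `L > 0` and every smooth, `L`-periodic, anti-Hermitian-matrix-valued gauge
potential `A_μ : ℝ⁴ → u(N)` (the image of any compact `G` in any `N`-dimensional unitary
representation is of this form), the Dirac operator `D̸_A = Σ_μ γ_μ (∂_μ + A_μ)` (tree
`euclideanGamma`, Hermitian, `{γ_μ, γ_ν} = 2δ_μν`) has a smooth `L`-periodic eigenspinor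
`ψ ≠ 0`, `D̸_A ψ = iλ ψ`, with `|λ| ≤ 2π/L`. (Existence of a smooth eigenfunction is how "λ₁ is an
eigenvalue" is rendered without spectral theory of unbounded operators; by elliptic regularity
it is equivalent.) Named fact, not a theorem: the proof is spectral flow / the
Atiyah–Patodi–Singer index theorem on `T⁴ × T⁴` (pp. 262–269), far outside Mathlib (no Dirac
operators, no index theory; searched `spectral flow`, `Atiyah`, `index theorem`, `Dirac operator`:
no relevant hits). Proved here: the free sanity case `A = 0` (constant spinor, `λ = 0`;
`vafaWitten_free`), and the refutation of the technique class `VafaWitten.HasDiracGap`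
(`VafaWittenEigenvalueBound.not_hasDiracGap`, `…no_uniform_gap`): no potential on a torus of side
`L ≥ 2π/g` has Dirac gap `g`. Also proved (VW p. 268, the family of constant `U(1)` fields
defining `λ_M`): the constant abelian slice `A_μ = i a_μ · 1_N`, `a ∈ ℝ⁴`, where plane waves
shifted into the first Brillouin zone and `(γ·v)² = |v|²` give an eigenvalue `iλ` with
`|λ| ≤ 2π/L` (`vafaWitten_constantAbelian`, `VafaWitten.cliffordVector_mul_self`).

Not vendored: general compact manifolds (20)–(21) (unspecified constants), the odd-`d` no-gap
statement (27), the `2+1`-dimensional applications (§IV), and the QCD no-mass-gap consequence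
itself (a physics-level derivation on top of the theorem; recorded in the block below).

## References

[VafaWitten1984CMP] [VafaWitten1984NPB] [tHooft1980Naturalness] [Smilga2001] [JaffeWitten2000]
[MontvayMunster1994]
-/

noncomputable section

open scoped ContDiff Matrix
open Literature.MathematicalPhysics.QuantumLattice

namespace Literature.Barriers.QuantumFields

namespace VafaWitten

/-- A spinor field on `ℝ⁴` with values in `ℂ⁴ ⊗ ℂ^N` (Dirac index `α : Fin 4` in the chiral
basis of `euclideanGamma`, colour index `a : Fin N`). [cite: VafaWitten1984CMP, §III p. 262] -/
abbrev SpinorField (N : ℕ) : Type := (Fin 4 → ℝ) → (Fin 4 → Fin N → ℂ)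

/-- A gauge potential on `ℝ⁴`: direction `μ ↦` point `↦` an `N × N` complex matrix (anti-Hermitian
in the statement: `A_μ(x) ∈ u(N)`, the Lie algebra of `U(N) ⊇` the image of any compact `G` in an
`N`-dimensional unitary representation). [cite: VafaWitten1984CMP, §III p. 262 and p. 268] -/
abbrev GaugePotential (N : ℕ) : Type := Fin 4 → (Fin 4 → ℝ) → Matrix (Fin N) (Fin N) ℂ

/-- `L`-periodicity in each coordinate direction: the function lives on the flat torus
`(ℝ/Lℤ)⁴` ("fermion fields that obey periodic boundary conditions", p. 267). [cite: VafaWitten1984CMP, p. 267] -/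
def IsPeriodic {E : Type*} (L : ℝ) (f : (Fin 4 → ℝ) → E) : Prop :=
  ∀ (x : Fin 4 → ℝ) (ν : Fin 4), f (x + Pi.single ν L) = f x

/-- The massless gauge-covariant Euclidean Dirac operator applied to a spinor field,
`(D̸_A ψ)(x)_{αa} = Σ_μ Σ_β (γ_μ)_{αβ} [ ∂_μ ψ_{βa}(x) + Σ_b A_μ(x)_{ab} ψ_{βb}(x) ]`, with the
tree's Hermitian Euclidean `γ`-matrices and `∂_μ ψ(x) = Dψ(x)(e_μ)` (Fréchet derivative; junk `0`
where `ψ` is not differentiable, immaterial under the smoothness hypothesis of the statement).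
For anti-Hermitian `A_μ` this operator is anti-Hermitian on periodic spinors, so its eigenvalues
are `iλ`, `λ ∈ ℝ` (VW write `D̸ = γ^j(∂_j + iA_j)` with Hermitian `A_j`). [cite: VafaWitten1984CMP, §III (28) p. 268] -/
def diracApply {N : ℕ} (A : GaugePotential N) (ψ : SpinorField N) (x : Fin 4 → ℝ) :
    Fin 4 → Fin N → ℂ :=
  fun α a => ∑ μ : Fin 4, ∑ β : Fin 4, euclideanGamma μ α β *
    (fderiv ℝ ψ x (Pi.single μ 1) β a + ∑ b : Fin N, A μ x a b * ψ x β b)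

/-- `iλ` is an eigenvalue of `D̸_A` on the torus of side `L`, witnessed by a smooth `L`-periodic
eigenspinor `ψ ≠ 0`. [cite: VafaWitten1984CMP, §III p. 262] -/
def IsDiracEigenvalue {N : ℕ} (L : ℝ) (A : GaugePotential N) (lam : ℝ) : Prop :=
  ∃ ψ : SpinorField N, ContDiff ℝ ∞ ψ ∧ IsPeriodic L ψ ∧ ψ ≠ 0 ∧
    ∀ x, diracApply A ψ x = ((lam : ℂ) * Complex.I) • ψ x

/-- **Technique class "the massless Dirac operator is gapped".** The potential `A` on the torus
of side `L` has Dirac gap `g`: no eigenvalue `iλ` with `|λ| ≤ g` — what any argument needs that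
controls massless (or uniformly-in-`m` light) quark propagators `(D̸_A + m)⁻¹` or the determinant
`det(D̸_A + m)` through `inf spec |D̸_A| ≥ g > 0` ("a depletion of the Dirac spectrum near
`λ = 0`", p. 258). [cite: VafaWitten1984CMP, §I p. 258 and §II p. 261] -/
def HasDiracGap {N : ℕ} (L g : ℝ) (A : GaugePotential N) : Prop :=
  ∀ lam : ℝ, IsDiracEigenvalue L A lam → g < |lam|

end VafaWitten

open VafaWitten

/-- **Vafa–Witten eigenvalue inequality, sharp flat-torus form in four dimensions**
(Commun. Math. Phys. 95 (1984), §III pp. 267–269, with (20) p. 262). For every `N ≥ 1`, every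
side `L > 0` and every smooth `L`-periodic anti-Hermitian gauge potential `A_μ : ℝ⁴ → u(N)`
(any compact gauge group in any `N`-dimensional unitary representation), the massless Dirac
operator `D̸_A = Σ_μ γ_μ(∂_μ + A_μ)` on periodic spinors has an eigenvalue `iλ` with
`|λ| ≤ λ_M = 2π/L` — "for any gauge field with any group `G`, `λ₁` is at most equal to `λ_M`",
`λ_M = ½√d` in `2π`-periodic coordinates, here `d = 4` rescaled to period `L`. In particular no
gauge field whatsoever opens a gap larger than `2π/L` around `0` in the Dirac spectrum, and the
bound tends to `0` with the volume. Named fact (proof by spectral flow / Atiyah–Patodi–Singer).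
[cite: VafaWitten1984CMP, §III (20) p. 262 and pp. 267–269]

BARRIER
technique_class: dirac-spectral-gap, gapped-massless-dirac-operator, volume-uniform-bound-on-massless-quark-propagator, fermion-determinant-control-via-spectral-gap, depletion-of-dirac-spectrum-near-zero, mass-uniform-light-quark-expansion — explicitly the class `VafaWitten.HasDiracGap L g A` (no eigenvalue `iλ` of `D̸_A` with `|λ| ≤ g`) required of the gauge fields `A` carrying the measure, with `g` independent of the volume [cite: VafaWitten1984CMP, §I p. 258, §II p. 261]
blocks: (formal scope) `HasDiracGap L g A` for ANY smooth potential once `L ≥ 2π/g` (`VafaWittenEigenvalueBound.no_uniform_gap`): every argument towards `ChiralRegime`/`QCDChiralOf 2, 3` or the conjunct `Literature.MathematicalPhysics.QuantumFieldTheory.QCD` that would bound light-quark propagators or determinants uniformly in the volume and in `m → 0⁺` through a spectral gap of the massless Dirac operator on the support of the measure; (printed consequence, cite-only) a MASS GAP for vector-like gauge theories with `n ≥ 4` flavours of zero bare mass and positive measure — "there is no mass gap in a channel with the quantum numbers of `q̄q`" [cite: VafaWitten1984CMP, §I p. 258, §II (5), (15) p. 261], the same conclusion for `n ≥ 2` following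 from triangle anomalies [cite: VafaWitten1984CMP, §I p. 258] [cite: tHooft1980Naturalness] (catalogued: `Literature.Barriers.QuantumFields.tHooftAnomalyMatching`); i.e. the strengthening of `QCD`/`ChiralRegime` to include the massless point with a gap, and any gap mechanism insensitive to the quark mass; it does not block — it supports — the clause `ReachesChiralRegime`
because: deform `D̸_A` by the bounded operator `X = iU⁻¹γ^i∂_iU` (`U : M → SU(N)` of winding number one, `‖X‖ = C` independent of `A`) to the unitarily equivalent `U⁻¹D̸_A U`; by the Atiyah–Patodi–Singer theorem the ordered eigenvalues flow by `q` units while none moves by more than `C`, so `λ₁ ≤ C` and (odd `d`) `|λ_{a+1} - λ_a| ≤ C`; even `d` via `N × S¹` [cite: VafaWitten1984CMP, §III (22)–(27) pp. 263–265]; on the flat torus the family `D̸_A - iγ·a` over constant `U(1)` fields `a` must have a zero mode for some `a` (index of a Dirac operator on `T^d × T^d`, after Gromov–Lawson), and `‖γ·a‖ ≤ λ_M` on the first Brillouin zone [cite: VafaWitten1984CMP, (28)–(31) pp. 268–269]; for QCD, `S_A(k) = V⁻¹Σλ_i^{-k} ≥ C V^{(k-4)/4}` pointwise in `A`, preserved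 by the POSITIVE measure (1), reproduces the infrared divergence of the free `S₀(k)` for `k ≥ 4`, incompatible with exponential clustering [cite: VafaWitten1984CMP, §II (5)–(15) pp. 259–261]
evasions_known: positive bare quark masses — `D̸_A + m` is trivially gapped by `m`, which is why `QCD` and `ChiralRegime` demand a gap only at `m > 0` [cite: VafaWitten1984CMP, §II p. 262 ("taking `λ_i → λ_i + im`")] [cite: JaffeWitten2000, §5]; non-positive path-integral weights escape the QCD consequence (not the eigenvalue theorem): with a parity-violating Chern–Simons mass in `2+1` dimensions "the Feynman path integrand is not positive definite … our method of proving the absence of a mass gap … does not work … there is in fact a mass gap" [cite: VafaWitten1984CMP, §IV p. 270]; fewer than four massless flavours escape the eigenvalue METHOD (disconnected contributions, p. 259) but for `n ≥ 2` not the anomaly argument [cite: VafaWitten1984CMP, §I p. 258] [cite: tHooft1980Naturalness]; gaps AWAY from zero in even dimensions are possible (constant magnetic field) [cite: VafaWitten1984CMP, p. 265]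
scope_caveats: (a) the formal `Prop` is the flat `4`-torus, periodic spinors, smooth potentials on the trivial bundle, sharp constant `2π/L` [cite: VafaWitten1984CMP, pp. 267–269] (VW note the index argument "tacitly assumes `A_j` was a connection on a trivial bundle" and assert bundle-independence without details, p. 269); general compact `M` with unspecified `C` (20)–(21), the excited-state bound `λ_n ≤ C n^{1/d}` and the odd-`d` statement (27) are docstring-only; (b) CONTINUUM Dirac operators only: nothing is claimed for the tree's lattice Wilson–Dirac operator `Literature.MathematicalPhysics.QuantumLattice.wilsonDirac` (not anti-Hermitian, no exact index theorem at finite spacing), so lattice arguments are constrained only inasmuch as their Dirac spectra near zero track the continuum operator's; (c) the no-mass-gap consequence is printed for `n ≥ 4` massless flavours, flavour-adjoint channels and positive measure, and "for rigor" needs ultraviolet cutoffs in both the fermion and the gauge sector [cite: VafaWitten1984CMP, §II p. 259]; `N_f = 2, 3` — the `ChiralRegime` flavours — are NOT covered by the eigenvalue method (only by anomaly matching), and about chiral symmetry breaking itself VW "can prove no theorems" [cite: VafaWitten1984CMP, §II p. 261]; (d) the theorem is silent at `m > 0` beyond `‖(D̸_A + m)⁻¹‖ ≤ 1/m` and gives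 no rate for the gap as `m → 0⁺` (no GMOR-type statement); (e) vector-symmetry and parity non-breaking (the other "Vafa–Witten theorem") is a different result [cite: VafaWitten1984NPB] [cite: Smilga2001, §14.1] and is not vendored here
status: established [cite: VafaWitten1984CMP]; the anomaly route to the same QCD conclusion [cite: tHooft1980Naturalness]
-/
def VafaWittenEigenvalueBound : Prop :=
  ∀ (N : ℕ) (L : ℝ), 0 < N → 0 < L → ∀ A : GaugePotential N,
    (∀ μ a b, ContDiff ℝ ∞ fun x => A μ x a b) → (∀ μ, IsPeriodic L (A μ)) →
    (∀ μ x, (A μ x)ᴴ = -A μ x) →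
      ∃ lam : ℝ, |lam| ≤ 2 * Real.pi / L ∧ IsDiracEigenvalue L A lam

/-! ### Proved: the free sanity case, and the refutation of the technique class -/

/-- **Free case** (`A = 0`): a constant spinor is a smooth periodic zero mode, so the conclusion
of `VafaWittenEigenvalueBound` holds with `λ = 0` ("For `a_i = 0`, the lowest Dirac eigenvalue is
`λ₁ = 0`, corresponding to an eigenfunction which is a constant spinor", p. 268). Shows the
conclusion is inhabited and the statement correctly typed. [cite: VafaWitten1984CMP, p. 268] -/
theorem vafaWitten_free (N : ℕ) (L : ℝ) (hN : 0 < N) (hL : 0 < L) :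
    ∃ lam : ℝ, |lam| ≤ 2 * Real.pi / L ∧ IsDiracEigenvalue L (fun _ _ => (0 : Matrix (Fin N) (Fin N) ℂ)) lam := by
  refine ⟨0, by simp [hL.le, Real.pi_pos.le, div_nonneg], ?_⟩
  -- the constant spinor with all components equal to `1`
  refine ⟨fun _ _ _ => 1, contDiff_const, fun _ _ => rfl, ?_, ?_⟩
  · intro h
    have := congrFun (congrFun (congrFun h 0) 0) ⟨0, hN⟩
    simp at this
  · intro x
    funext α a
    simp [diracApply]

/-- **The theorem empties the technique class**: under `VafaWittenEigenvalueBound`, NO smooth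
periodic anti-Hermitian potential on the torus of side `L` has Dirac gap `2π/L` (or larger).
[cite: VafaWitten1984CMP, §III p. 269] -/
theorem VafaWittenEigenvalueBound.not_hasDiracGap (H : VafaWittenEigenvalueBound) {N : ℕ} {L : ℝ}
    (hN : 0 < N) (hL : 0 < L) (A : GaugePotential N)
    (hs : ∀ μ a b, ContDiff ℝ ∞ fun x => A μ x a b) (hp : ∀ μ, IsPeriodic L (A μ))
    (ha : ∀ μ x, (A μ x)ᴴ = -A μ x) {g : ℝ} (hg : 2 * Real.pi / L ≤ g) :
    ¬ HasDiracGap L g A := by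
  intro hgap
  obtain ⟨lam, hlam, heig⟩ := H N L hN hL A hs hp ha
  have := hgap lam heig
  linarith

/-- **No volume-uniform Dirac gap**: for any `g > 0`, once the torus side is `L ≥ 2π/g`, no
gauge field has Dirac gap `g` — the bound `λ₁ ≤ C V^{-1/d}` "blowing down" with the volume
((9), p. 260). This is the form in which the barrier bites on infinite-volume (`a_k L_k → ∞`)
constructions. [cite: VafaWitten1984CMP, §II (9) p. 260 and §III p. 269] -/
theorem VafaWittenEigenvalueBound.no_uniform_gap (H : VafaWittenEigenvalueBound) {N : ℕ}
    (hN : 0 < N) {g : ℝ} (hg : 0 < g) {L : ℝ} (hL : 2 * Real.pi / g ≤ L) (A : GaugePotential N)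
    (hs : ∀ μ a b, ContDiff ℝ ∞ fun x => A μ x a b) (hp : ∀ μ, IsPeriodic L (A μ))
    (ha : ∀ μ x, (A μ x)ᴴ = -A μ x) : ¬ HasDiracGap L g A := by
  have hπ : 0 < 2 * Real.pi := by positivity
  have hL0 : 0 < L := lt_of_lt_of_le (div_pos hπ hg) hL
  refine H.not_hasDiracGap hN hL0 A hs hp ha ?_
  rw [div_le_iff₀ hL0]
  calc 2 * Real.pi = (2 * Real.pi / g) * g := by field_simp
    _ ≤ L * g := mul_le_mul_of_nonneg_right hL hg.le
    _ = g * L := mul_comm _ _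

/-! ### Proved: the constant abelian slice — plane waves and the Brillouin zone (VW p. 268)

For a constant `U(1)` potential `A_μ = i a_μ · 1` the eigenspinors are plane waves
`exp(i k·x) η`, `k ∈ (2π/L)ℤ⁴`, on which `D̸_A` reduces to `i γ·(k + a)`; since
`(γ·v)² = |v|²` ("The square of that operator is `g^{ij}(m_i - a_i)(m_j - a_j)` (since
`γ_iγ_j + γ_jγ_i = 2g_ij`), so the eigenvalues are `±√(g^{ij}(m_i - a_i)(m_j - a_j))`", p. 268) the
eigenvalues are `±i|k + a|`, and shifting `k` into the first Brillouin zone (`|k_μ + a_μ| ≤ π/L`)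
gives `|λ| ≤ ½√4 · (2π/L) = 2π/L = λ_M`.  This is the family of operators over which VW define
`λ_M` (p. 268, before (28)); it shows the conclusion of `VafaWittenEigenvalueBound` on that slice,
with the vendored constant.  (That `2π/L` is attained — every eigenvalue of `A_μ = i(π/L)·1` has
`|λ| ≥ 2π/L` — is VW's "the maximum of `λ₁` occurs for `a_i = 1/2`"; it needs Parseval on `T⁴` and
is not formalized here.) -/

namespace VafaWitten

/-- `γ·v = Σ_μ v_μ γ_μ` for `v ∈ ℝ⁴` — VW's `X(a_i) = Σ_j γ^j a_j` (p. 268). [cite: VafaWitten1984CMP, §III p. 268] -/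
def cliffordVector (v : Fin 4 → ℝ) : Matrix (Fin 4) (Fin 4) ℂ :=
  ∑ μ, (v μ : ℂ) • euclideanGamma μ

/-- Entries of `γ·v`: `(γ·v)_{αβ} = Σ_μ v_μ (γ_μ)_{αβ}`. [folklore] -/
theorem cliffordVector_apply (v : Fin 4 → ℝ) (α β : Fin 4) :
    cliffordVector v α β = ∑ μ, (v μ : ℂ) * euclideanGamma μ α β := by
  simp [cliffordVector, Matrix.sum_apply]

/-- **Clifford square** `(γ·v)² = |v|² · 1`, from `{γ_μ, γ_ν} = 2δ_μν`
(`euclideanGamma_anticomm_holds`). [cite: VafaWitten1984CMP, §III p. 268] -/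
theorem cliffordVector_mul_self (v : Fin 4 → ℝ) :
    cliffordVector v * cliffordVector v =
      ((∑ μ, v μ ^ 2 : ℝ) : ℂ) • (1 : Matrix (Fin 4) (Fin 4) ℂ) := by
  classical
  set f : Fin 4 → Fin 4 → Matrix (Fin 4) (Fin 4) ℂ :=
    fun μ ν => ((v μ : ℂ) * (v ν : ℂ)) • (euclideanGamma μ * euclideanGamma ν) with hf
  have hT : cliffordVector v * cliffordVector v = ∑ μ, ∑ ν, f μ ν := by
    rw [cliffordVector, Finset.sum_mul]
    refine Finset.sum_congr rfl fun μ _ => ?_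
    rw [Finset.mul_sum]
    refine Finset.sum_congr rfl fun ν _ => ?_
    rw [smul_mul_assoc, mul_smul_comm, smul_smul]
  have hsymm : ∑ μ, ∑ ν, f μ ν = ∑ μ, ∑ ν, f ν μ := Finset.sum_comm
  have hpair : ∀ μ ν, f μ ν + f ν μ =
      ((v μ : ℂ) * (v ν : ℂ)) • (if μ = ν then (2 : Matrix (Fin 4) (Fin 4) ℂ) else 0) := by
    intro μ ν
    rw [← euclideanGamma_anticomm_holds μ ν, smul_add, hf]
    simp only [mul_comm (v ν : ℂ) (v μ : ℂ)]
  have hM2 : (2 : Matrix (Fin 4) (Fin 4) ℂ) = (2 : ℂ) • (1 : Matrix (Fin 4) (Fin 4) ℂ) := by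
    ext i j
    simp [Matrix.ofNat_apply, Matrix.one_apply]
  have h2 : (2 : ℂ) • (cliffordVector v * cliffordVector v) =
      (2 : ℂ) • (((∑ μ, v μ ^ 2 : ℝ) : ℂ) • (1 : Matrix (Fin 4) (Fin 4) ℂ)) := by
    calc (2 : ℂ) • (cliffordVector v * cliffordVector v)
        = (∑ μ, ∑ ν, f μ ν) + ∑ μ, ∑ ν, f ν μ := by rw [two_smul, hT, ← hsymm]
      _ = ∑ μ, ∑ ν, (f μ ν + f ν μ) := by simp only [Finset.sum_add_distrib]
      _ = ∑ μ, ((v μ : ℂ) * (v μ : ℂ)) • (2 : Matrix (Fin 4) (Fin 4) ℂ) := by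
          simp only [hpair, smul_ite, smul_zero, Finset.sum_ite_eq, Finset.mem_univ, if_true]
      _ = (∑ μ, (v μ : ℂ) * (v μ : ℂ)) • ((2 : ℂ) • (1 : Matrix (Fin 4) (Fin 4) ℂ)) := by
          rw [← Finset.sum_smul, hM2]
      _ = (2 : ℂ) • (((∑ μ, v μ ^ 2 : ℝ) : ℂ) • (1 : Matrix (Fin 4) (Fin 4) ℂ)) := by
          rw [smul_comm]
          congr 1
          push_cast
          simp only [sq]
  exact smul_right_injective _ (two_ne_zero' ℂ) h2

/-- Every `γ·v` has an eigenvector with eigenvalue `±|v|` (so `‖γ·v‖ = |v|`, the norm VW use on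
p. 268). [cite: VafaWitten1984CMP, §III p. 268] -/
theorem exists_eigenvector_cliffordVector (v : Fin 4 → ℝ) :
    ∃ (η : Fin 4 → ℂ) (s : ℝ), η ≠ 0 ∧ |s| = √(∑ μ, v μ ^ 2) ∧
      (cliffordVector v).mulVec η = (s : ℂ) • η := by
  classical
  set r : ℝ := √(∑ μ, v μ ^ 2) with hr
  have hr0 : 0 ≤ r := Real.sqrt_nonneg _
  have hrr : (r : ℂ) * (r : ℂ) = ((∑ μ, v μ ^ 2 : ℝ) : ℂ) := by
    rw [← Complex.ofReal_mul, Real.mul_self_sqrt (Finset.sum_nonneg fun μ _ => sq_nonneg (v μ))]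
  set P : Matrix (Fin 4) (Fin 4) ℂ := cliffordVector v + (r : ℂ) • 1 with hP
  have hMP : cliffordVector v * P = (r : ℂ) • P := by
    rw [hP, mul_add, cliffordVector_mul_self, mul_smul_comm, mul_one, smul_add, smul_smul, hrr,
      add_comm]
  by_cases h0 : P = 0
  · -- `γ·v = -|v|·1`: any basis vector is an eigenvector with eigenvalue `-|v|`
    have hM : cliffordVector v = -((r : ℂ) • (1 : Matrix (Fin 4) (Fin 4) ℂ)) :=
      eq_neg_of_add_eq_zero_left (hP ▸ h0)
    refine ⟨Pi.single 0 1, -r, ?_, by rw [abs_neg, abs_of_nonneg hr0], ?_⟩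
    · intro h
      have := congrFun h 0
      simp at this
    · rw [hM, Matrix.neg_mulVec, Matrix.smul_mulVec, Matrix.one_mulVec]
      push_cast
      rw [neg_smul]
  · -- some column of `P = γ·v + |v|` is non-zero, and `(γ·v) P = |v| P`
    obtain ⟨i, j, hij⟩ : ∃ i j, P i j ≠ 0 := by
      by_contra hcon
      push Not at hcon
      exact h0 (Matrix.ext hcon)
    refine ⟨fun l => P l j, r, ?_, abs_of_nonneg hr0, ?_⟩
    · intro h
      exact hij (congrFun h i)
    · ext l
      have := congrFun (congrFun hMP l) j
      simpa [Matrix.mul_apply, Matrix.mulVec, dotProduct] using this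

/-- The constant abelian potential `A_μ(x) = i a_μ · 1_N` (`a ∈ ℝ⁴`): VW's family
`A_i = (a_1, …, a_d)` of constant `U(1)` gauge fields (p. 267), embedded diagonally in `u(N)`.
[cite: VafaWitten1984CMP, §III pp. 267–268] -/
def constantAbelianPotential (N : ℕ) (a : Fin 4 → ℝ) : GaugePotential N :=
  fun μ _ => ((a μ : ℂ) * Complex.I) • (1 : Matrix (Fin N) (Fin N) ℂ)

/-- The constant abelian potentials satisfy the hypotheses of `VafaWittenEigenvalueBound`:
smooth, `L`-periodic for every `L`, anti-Hermitian. [cite: VafaWitten1984CMP, §III p. 267] -/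
theorem constantAbelianPotential_hypotheses (N : ℕ) (L : ℝ) (a : Fin 4 → ℝ) :
    (∀ μ c d, ContDiff ℝ ∞ fun x => constantAbelianPotential N a μ x c d) ∧
    (∀ μ, IsPeriodic L (constantAbelianPotential N a μ)) ∧
    (∀ μ x, (constantAbelianPotential N a μ x)ᴴ = -constantAbelianPotential N a μ x) := by
  refine ⟨fun μ c d => contDiff_const, fun μ x ν => rfl, fun μ x => ?_⟩
  simp only [constantAbelianPotential, Matrix.conjTranspose_smul, Matrix.conjTranspose_one,
    ← neg_smul]
  congr 1
  simp [Complex.conj_ofReal]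

/-- The phase `x ↦ i k·x` of a plane wave, as a real-linear map `ℝ⁴ → ℂ`. [folklore] -/
def planeWavePhase (k : Fin 4 → ℝ) : (Fin 4 → ℝ) →L[ℝ] ℂ :=
  ∑ μ, ((k μ : ℂ) * Complex.I) • (Complex.ofRealCLM.comp (ContinuousLinearMap.proj μ))

/-- `planeWavePhase k x = i Σ_μ k_μ x_μ`. [folklore] -/
theorem planeWavePhase_apply (k x : Fin 4 → ℝ) :
    planeWavePhase k x = ∑ μ, ((k μ : ℂ) * Complex.I) * (x μ : ℂ) := by
  simp [planeWavePhase]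

/-- The phase on a coordinate vector: `planeWavePhase k (t e_ν) = i k_ν t`. [folklore] -/
theorem planeWavePhase_single (k : Fin 4 → ℝ) (ν : Fin 4) (t : ℝ) :
    planeWavePhase k (Pi.single ν t) = ((k ν : ℂ) * Complex.I) * (t : ℂ) := by
  rw [planeWavePhase_apply, Fintype.sum_eq_single ν]
  · rw [Pi.single_eq_same]
  · intro μ hμ
    rw [Pi.single_eq_of_ne hμ, Complex.ofReal_zero, mul_zero]

/-- The plane-wave spinor `ψ(x)_{αb} = exp(i k·x) η_α δ_{b a₀}` ("the eigenfunctions are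
`ψ(φ^i) = (exp iΣ m_iφ^i) η`, where `η` is a constant spinor", p. 268). [cite: VafaWitten1984CMP, §III p. 268] -/
def planeWave {N : ℕ} (k : Fin 4 → ℝ) (η : Fin 4 → ℂ) (a₀ : Fin N) : SpinorField N :=
  fun x => Complex.exp (planeWavePhase k x) • fun α b => if b = a₀ then η α else 0

/-- Components of the plane wave: `ψ(x)_{αb} = exp(i k·x) η_α δ_{b a₀}`. [folklore] -/
theorem planeWave_apply {N : ℕ} (k : Fin 4 → ℝ) (η : Fin 4 → ℂ) (a₀ : Fin N) (x : Fin 4 → ℝ)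
    (α : Fin 4) (b : Fin N) :
    planeWave k η a₀ x α b = Complex.exp (planeWavePhase k x) * (if b = a₀ then η α else 0) := by
  simp [planeWave]

/-- Plane waves are smooth. [folklore] -/
theorem contDiff_planeWave {N : ℕ} (k : Fin 4 → ℝ) (η : Fin 4 → ℂ) (a₀ : Fin N) :
    ContDiff ℝ ∞ (planeWave k η a₀) :=
  ((planeWavePhase k).contDiff.cexp).smul contDiff_const

/-- The Fréchet derivative of a plane wave: `Dψ(x) v = (i k·v) ψ(x)`. [folklore] -/
theorem hasFDerivAt_planeWave {N : ℕ} (k : Fin 4 → ℝ) (η : Fin 4 → ℂ) (a₀ : Fin N)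
    (x : Fin 4 → ℝ) :
    HasFDerivAt (planeWave k η a₀)
      ((Complex.exp (planeWavePhase k x) • planeWavePhase k).smulRight
        (fun α b => if b = a₀ then η α else (0 : ℂ))) x :=
  ((planeWavePhase k).hasFDerivAt.cexp).smul_const _

/-- Partial derivatives of a plane wave: `∂_μ ψ(x) = i k_μ ψ(x)`. [folklore] -/
theorem fderiv_planeWave_single {N : ℕ} (k : Fin 4 → ℝ) (η : Fin 4 → ℂ) (a₀ : Fin N)
    (x : Fin 4 → ℝ) (μ α : Fin 4) (b : Fin N) :
    fderiv ℝ (planeWave k η a₀) x (Pi.single μ 1) α b =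
      Complex.exp (planeWavePhase k x) * ((k μ : ℂ) * Complex.I) *
        (if b = a₀ then η α else 0) := by
  rw [(hasFDerivAt_planeWave k η a₀ x).fderiv, ContinuousLinearMap.smulRight_apply]
  simp only [smul_apply, Pi.smul_apply, smul_eq_mul, planeWavePhase_single, Complex.ofReal_one,
    mul_one]

/-- A plane wave with wave vector in `(2π/L)ℤ⁴` is `L`-periodic. [cite: VafaWitten1984CMP, §III p. 267] -/
theorem planeWave_periodic {N : ℕ} {L : ℝ} (hL : L ≠ 0) (n : Fin 4 → ℤ) (η : Fin 4 → ℂ)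
    (a₀ : Fin N) :
    IsPeriodic L (planeWave (fun μ => 2 * Real.pi * n μ / L) η a₀) := by
  intro x ν
  have hphase : planeWavePhase (fun μ => 2 * Real.pi * n μ / L) (x + Pi.single ν L) =
      planeWavePhase (fun μ => 2 * Real.pi * n μ / L) x + (n ν : ℂ) * (2 * Real.pi * Complex.I) := by
    rw [map_add, planeWavePhase_single]
    congr 1
    have hL' : (L : ℂ) ≠ 0 := Complex.ofReal_ne_zero.mpr hL
    push_cast
    field_simp
  funext α b
  rw [planeWave_apply, planeWave_apply, hphase, Complex.exp_add, Complex.exp_int_mul_two_pi_mul_I,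
    mul_one]

/-- A plane wave with non-zero spinor amplitude is not the zero spinor field. [folklore] -/
theorem planeWave_ne_zero {N : ℕ} (k : Fin 4 → ℝ) {η : Fin 4 → ℂ} (hη : η ≠ 0) (a₀ : Fin N) :
    planeWave k η a₀ ≠ 0 := by
  obtain ⟨α, hα⟩ : ∃ α, η α ≠ 0 := by
    by_contra hcon
    push Not at hcon
    exact hη (funext hcon)
  intro h
  have := congrFun (congrFun (congrFun h 0) α) a₀
  rw [planeWave_apply] at this
  simp [hα] at this

/-- On a plane wave the Dirac operator with constant abelian potential `a` is the matrix
`i γ·(k + a)` acting on the constant spinor ("On such a state the Dirac operator reduces to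
`γ^j(m_j - a_j)`", p. 268, in VW's sign convention). [cite: VafaWitten1984CMP, §III p. 268] -/
theorem diracApply_planeWave {N : ℕ} (a k : Fin 4 → ℝ) (η : Fin 4 → ℂ) (a₀ : Fin N)
    (x : Fin 4 → ℝ) (α : Fin 4) (b : Fin N) :
    diracApply (constantAbelianPotential N a) (planeWave k η a₀) x α b =
      Complex.exp (planeWavePhase k x) * Complex.I *
        (if b = a₀ then (cliffordVector (k + a)).mulVec η α else 0) := by
  classical
  simp only [diracApply, fderiv_planeWave_single, planeWave_apply, constantAbelianPotential,
    Matrix.smul_apply, Matrix.one_apply, smul_eq_mul, mul_ite, mul_one, mul_zero, ite_mul, zero_mul,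
    Finset.sum_ite_eq', Finset.mem_univ, if_true]
  by_cases hb : b = a₀
  · simp only [hb, if_true, Matrix.mulVec, dotProduct, cliffordVector_apply, Pi.add_apply,
      Complex.ofReal_add, Finset.sum_mul, Finset.mul_sum]
    rw [Finset.sum_comm]
    refine Finset.sum_congr rfl fun β _ => Finset.sum_congr rfl fun μ _ => ?_
    ring
  · simp [hb]

/-- For every `a ∈ ℝ` there is an integer `n` with `|a + 2πn/L| ≤ π/L` (shift into the first
Brillouin zone, p. 268). [cite: VafaWitten1984CMP, §III p. 268] -/
theorem exists_brillouin_shift {L : ℝ} (hL : 0 < L) (a : ℝ) :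
    |2 * Real.pi * (round (-a * L / (2 * Real.pi)) : ℤ) / L + a| ≤ Real.pi / L := by
  set t : ℝ := -a * L / (2 * Real.pi) with ht
  have hπ : 0 < 2 * Real.pi := by positivity
  have hround := abs_sub_round t
  have hkey : 2 * Real.pi * (round t : ℝ) / L + a = (2 * Real.pi / L) * ((round t : ℝ) - t) := by
    rw [ht]
    field_simp
    ring
  rw [hkey, abs_mul, abs_of_pos (div_pos hπ hL), abs_sub_comm]
  calc 2 * Real.pi / L * |t - round t| ≤ 2 * Real.pi / L * (1 / 2) :=
        mul_le_mul_of_nonneg_left hround (div_pos hπ hL).le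
    _ = Real.pi / L := by ring

end VafaWitten

/-- **The constant abelian slice of the Vafa–Witten bound** (VW p. 268): for every `N ≥ 1`,
`L > 0` and every constant abelian potential `A_μ = i a_μ · 1_N`, `a ∈ ℝ⁴` (smooth, periodic and
anti-Hermitian: `constantAbelianPotential_hypotheses`), `D̸_A` has a smooth `L`-periodic
eigenspinor — the plane wave `exp(i k·x) η ⊗ e₀` with `k ∈ (2π/L)ℤ⁴` in the Brillouin zone of
`-a` and `η` an eigenvector of `γ·(k + a)` — with eigenvalue `iλ`, `|λ| = |k + a| ≤ 2π/L = λ_M`.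
This is the conclusion of `VafaWittenEigenvalueBound` on the family of potentials over which VW
define `λ_M`; the general statement (any gauge field) is the named fact above. [cite: VafaWitten1984CMP, §III pp. 267–268] -/
theorem vafaWitten_constantAbelian (N : ℕ) (L : ℝ) (hN : 0 < N) (hL : 0 < L) (a : Fin 4 → ℝ) :
    ∃ lam : ℝ, |lam| ≤ 2 * Real.pi / L ∧
      IsDiracEigenvalue L (constantAbelianPotential N a) lam := by
  -- wave vector `k ∈ (2π/L)ℤ⁴` with `k + a` in the first Brillouin zone
  set n : Fin 4 → ℤ := fun μ => round (-a μ * L / (2 * Real.pi)) with hn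
  set k : Fin 4 → ℝ := fun μ => 2 * Real.pi * n μ / L with hk
  have hv : ∀ μ, |(k + a) μ| ≤ Real.pi / L := fun μ => exists_brillouin_shift hL (a μ)
  obtain ⟨η, s, hη, hs, hM⟩ := exists_eigenvector_cliffordVector (k + a)
  refine ⟨s, ?_, planeWave k η ⟨0, hN⟩, contDiff_planeWave k η _, planeWave_periodic hL.ne' n η _,
    planeWave_ne_zero k hη _, fun x => ?_⟩
  · -- `|s| = |k + a| ≤ √(4 (π/L)²) = 2π/L`
    rw [hs]
    have hsum : ∑ μ, (k + a) μ ^ 2 ≤ (2 * Real.pi / L) ^ 2 := by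
      have hterm : ∀ μ, (k + a) μ ^ 2 ≤ (Real.pi / L) ^ 2 := fun μ =>
        sq_le_sq.mpr ((hv μ).trans (le_abs_self _))
      calc ∑ μ, (k + a) μ ^ 2 ≤ ∑ _μ : Fin 4, (Real.pi / L) ^ 2 := Finset.sum_le_sum fun μ _ => hterm μ
        _ = (2 * Real.pi / L) ^ 2 := by simp; ring
    calc √(∑ μ, (k + a) μ ^ 2) ≤ √((2 * Real.pi / L) ^ 2) := Real.sqrt_le_sqrt hsum
      _ = 2 * Real.pi / L := Real.sqrt_sq (by positivity)
  · funext α b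
    rw [diracApply_planeWave, Pi.smul_apply, Pi.smul_apply, smul_eq_mul, planeWave_apply]
    by_cases hb : b = (⟨0, hN⟩ : Fin N)
    · rw [if_pos hb, if_pos hb, hM, Pi.smul_apply, smul_eq_mul]
      ring
    · rw [if_neg hb, if_neg hb]
      ring

end Literature.Barriers.QuantumFields

end
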